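import Summits.QuantumFields.YangMills.Theorems.ColdStartUniversalityLatticeLangevinLawTransport
import Literature.Probability.Process.ItoIntegralFiltrationChange
import HarnessLib

/-!
# Route `ColdStartUniversality` (coupling infrastructure): SZZ solutions under ENLARGEMENT OF THE FILTRATION and an
# INDISTINGUISHABLE DRIVER

Helper file (seat `ym-line-csu-p1`, g13; `--supports stmt-QuantumFields-27872`).  Companion of
`…LatticeLangevinFiltrationUniqueness` (pathwise uniqueness w.r.t. an arbitrary filtration) for the coupling lines
(blocked item `defn-UnitScaleMixedCoupling`; TP 27872/27873, CSU 27403/27404): a solution `U` of the SU(2) SZZ system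
driven by `W` and adapted to `𝓕` is ALSO a solution driven by any indistinguishable driver `W'` (`W' = W` at all times,
a.s.) w.r.t. any larger filtration `𝓖 ≥ 𝓕` in which the coordinates of `W'` are Brownian motions in martingale form
(`isSolution_of_filtration_le`).  Typical use: `W = ∫ R dB` a rotated noise (a.s. continuous, `σ(B)`-adapted;
`…NoiseStochasticRotation`), `W' = W̃` its continuous modification, `𝓖 = σ(B) ⊔ σ(N)` the enlargement by the
exceptional null set (martingales survive: `Literature…MartingaleNullEnlargement`); then `…FiltrationUniqueness`
compares `U` with the transported canonical strong solution driven by `W̃`.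

Tools: the tree's `dyadicReg` (progressive versions of adapted a.s.-continuous integrands),
`IsItoIntegral.congr_integrand_ae`, and this seat's `IsItoIntegral.congr_integrator_ae` /
`IsItoIntegral.exists_of_filtration_le` (`Literature…ItoIntegralFiltrationChange`).  THEOREMS ONLY, no sorry, standard
axioms.  HONEST FRAMING: plumbing; no coupling is constructed; no crux, rung R3 or summit is proved; the Yang–Mills
mass gap is NOT proved.
-/

set_option autoImplicit false

noncomputable section

namespace Summit.QuantumFields.YangMills.Theorems.ColdStartUniversality

open MeasureTheory ProbabilityTheory Filter Topology
open scoped NNReal ENNReal BigOperators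
open Literature.Probability.Process Literature.Analysis.FunctionSpaces
open Literature.MathematicalPhysics.QuantumFieldTheory
open Literature.MathematicalPhysics.QuantumLattice (fundamentalRep fundamentalLatticeRep continuous_fundamentalRep)

variable {Ω : Type*} {mΩ : MeasurableSpace Ω} {P : Measure Ω} {𝓕 𝓖 : Filtration ℝ≥0 mΩ} {L : ℕ} [NeZero L]
  {W W' : ℝ≥0 → Ω → (Edge 3 L × NoiseIdx 2 → ℝ)}

/-- **One stochastic integral of a continuous function of an adapted a.s.-continuous process, moved to a larger
filtration and an indistinguishable integrator.**  If `J = ∫ g(U) dW^k` w.r.t. `𝓕`, `𝓕 ≤ 𝓖`, `W'^k = W^k` a.s. at all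
times, and `W'^k` is a Brownian motion of `𝓖` in martingale form, then some `J'` indistinguishable from `J` is
`∫ g(U) dW'^k` w.r.t. `𝓖`. [cite: RevuzYor1999, Ch. IV Prop. (2.13)] -/
theorem exists_isItoIntegral_of_filtration_le [IsProbabilityMeasure P] (hle : ∀ t, 𝓕 t ≤ 𝓖 t) (k : Edge 3 L × NoiseIdx 2)
    (hW'm : Martingale (fun t ω => W' t ω k) 𝓖 P)
    (hW'sq : Martingale (fun t ω => W' t ω k ^ 2 - (t : ℝ)) 𝓖 P)
    (hW'2 : ∀ t, MemLp (fun ω => W' t ω k) 2 P) (hW'c : ∀ ω, Continuous fun t => W' t ω k)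
    (hWW' : ∀ᵐ ω ∂P, ∀ t, W' t ω k = W t ω k)
    {g : GaugeConfig 3 L (Matrix.specialUnitaryGroup (Fin 2) ℂ) → ℝ} (hg : Continuous g)
    {U : ℝ≥0 → Ω → GaugeConfig 3 L (Matrix.specialUnitaryGroup (Fin 2) ℂ)}
    (hUa : ∀ t, Measurable[𝓕 t] (U t)) (hUc : ∀ᵐ ω ∂P, Continuous fun t => U t ω)
    {J : ℝ≥0 → Ω → ℝ} (hJ : IsItoIntegral (fun t ω => g (U t ω)) (fun t ω => W t ω k) J 𝓕 P) :
    ∃ J' : ℝ≥0 → Ω → ℝ, IsItoIntegral (fun t ω => g (U t ω)) (fun t ω => W' t ω k) J' 𝓖 P ∧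
      ∀ᵐ ω ∂P, ∀ t, J' t ω = J t ω := by
  -- the integrand: `𝓖`-adapted, a.s. continuous, bounded
  set H : ℝ≥0 → Ω → ℝ := fun t ω => g (U t ω) with hHdef
  have hHa : Adapted 𝓖 H := by
    intro t
    exact hg.measurable.comp ((hUa t).mono (hle t) le_rfl)
  have hHc : ∀ᵐ ω ∂P, Continuous fun t => H t ω := by
    filter_upwards [hUc] with ω hω
    exact hg.comp hω
  obtain ⟨x₀, -, hx₀⟩ := isCompact_univ.exists_isMaxOn Set.univ_nonempty (hg.abs.continuousOn)
  have hHb : ∀ ω s, |H s ω| ≤ |g x₀| := fun ω s => hx₀ (Set.mem_univ _)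
  -- progressive version
  have hRp : IsStronglyProgressive 𝓖 (dyadicReg H) := isStronglyProgressive_dyadicReg hHa
  have hRH : ∀ᵐ ω ∂P, ∀ t, dyadicReg H t ω = H t ω := by
    filter_upwards [hHc] with ω hω t
    exact dyadicReg_apply_of_continuous hω t
  have hfin : ∀ t : ℝ≥0, sqErr (dyadicReg H) 0 P t ≠ ⊤ := fun t => by
    refine sqErr_zero_ne_top_of_ae_abs_le (C := |g x₀|) ?_ t
    filter_upwards [hRH] with ω hω s
    rw [hω s]
    exact hHb ω s
  -- move `J`: integrand to its progressive version, integrator to `W'`, filtration to `𝓖`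
  have h1 : IsItoIntegral (dyadicReg H) (fun t ω => W' t ω k) J 𝓕 P :=
    (hJ.congr_integrand_ae (hRH.mono fun ω hω t => (hω t).symm)).congr_integrator_ae hWW'
  obtain ⟨J', hJ', -, -, hae⟩ := h1.exists_of_filtration_le hle hW'm hW'sq hW'2 hW'c hRp hfin
  exact ⟨J', hJ'.congr_integrand_ae hRH, hae⟩

/-- ★ **SZZ solutions under enlargement of the filtration and an indistinguishable driver.**  Let `U` solve the
SU(2) SZZ system `latticeLangevinDynamics (fundamentalLatticeRep 2) β` driven by `W` w.r.t. `𝓕`; let `𝓕 ≤ 𝓖` and let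
`W'` be a process with `W' = W` at all times a.s. whose coordinates are continuous square-integrable `𝓖`-martingales
with `(W'^a)² - t` martingales.  Then `U` solves the same system driven by `W'` w.r.t. `𝓖`.
[cite: RevuzYor1999, Ch. IX Def. (1.2) and (1.5)] -/
theorem isSolution_of_filtration_le [IsProbabilityMeasure P] (β : ℝ) (hle : ∀ t, 𝓕 t ≤ 𝓖 t)
    (hW'm : ∀ a, Martingale (fun t ω => W' t ω a) 𝓖 P)
    (hW'sq : ∀ a, Martingale (fun t ω => W' t ω a ^ 2 - (t : ℝ)) 𝓖 P)
    (hW'2 : ∀ t a, MemLp (fun ω => W' t ω a) 2 P) (hW'c : ∀ a ω, Continuous fun t => W' t ω a)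
    (hWW' : ∀ᵐ ω ∂P, ∀ t, W' t ω = W t ω)
    {U : ℝ≥0 → Ω → GaugeConfig 3 L (Matrix.specialUnitaryGroup (Fin 2) ℂ)}
    (hU : (latticeLangevinDynamics (fundamentalLatticeRep 2) β).IsSolution (fundamentalRep (Fin 2)) 𝓕 P W U) :
    (latticeLangevinDynamics (fundamentalLatticeRep 2) β).IsSolution (fundamentalRep (Fin 2)) 𝓖 P W' U := by
  obtain ⟨J, hJC, hUeq⟩ := hU.exists_ito
  have hWW'k : ∀ k : Edge 3 L × NoiseIdx 2, ∀ᵐ ω ∂P, ∀ t, W' t ω k = W t ω k := fun k =>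
    hWW'.mono fun ω hω t => by rw [hω t]
  -- real and imaginary parts of every entry integral, moved
  have hre : ∀ (e : Edge 3 L) (n : NoiseIdx 2) (i j : Fin 2), ∃ J' : ℝ≥0 → Ω → ℝ,
      IsItoIntegral (fun t ω => ((latticeLangevinDynamics (fundamentalLatticeRep 2) β).noise
          (matrixConfig (fundamentalRep (Fin 2)) (U t ω)) e n i j).re) (fun t ω => W' t ω (e, n)) J' 𝓖 P ∧
        ∀ᵐ ω ∂P, ∀ t, J' t ω = (J e n i j t ω).re := fun e n i j =>
    exists_isItoIntegral_of_filtration_le hle (e, n) (hW'm _) (hW'sq _) (fun t => hW'2 t _) (hW'c _) (hWW'k _)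
      (g := fun V => ((latticeLangevinDynamics (fundamentalLatticeRep 2) β).noise
        (matrixConfig (fundamentalRep (Fin 2)) V) e n i j).re)
      (Complex.continuous_re.comp (continuous_noise_entry β e n i j)) hU.adapted hU.continuous (hJC e n i j).1
  have him : ∀ (e : Edge 3 L) (n : NoiseIdx 2) (i j : Fin 2), ∃ J' : ℝ≥0 → Ω → ℝ,
      IsItoIntegral (fun t ω => ((latticeLangevinDynamics (fundamentalLatticeRep 2) β).noise
          (matrixConfig (fundamentalRep (Fin 2)) (U t ω)) e n i j).im) (fun t ω => W' t ω (e, n)) J' 𝓖 P ∧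
        ∀ᵐ ω ∂P, ∀ t, J' t ω = (J e n i j t ω).im := fun e n i j =>
    exists_isItoIntegral_of_filtration_le hle (e, n) (hW'm _) (hW'sq _) (fun t => hW'2 t _) (hW'c _) (hWW'k _)
      (g := fun V => ((latticeLangevinDynamics (fundamentalLatticeRep 2) β).noise
        (matrixConfig (fundamentalRep (Fin 2)) V) e n i j).im)
      (Complex.continuous_im.comp (continuous_noise_entry β e n i j)) hU.adapted hU.continuous (hJC e n i j).2
  choose Jr hJr hJrae using hre
  choose Ji hJi hJiae using him
  refine ⟨fun t => (hU.adapted t).mono (hle t) le_rfl, hU.continuous,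
    ⟨fun e n i j t ω => ⟨Jr e n i j t ω, Ji e n i j t ω⟩, fun e n i j => ⟨hJr e n i j, hJi e n i j⟩, ?_⟩⟩
  -- the integral equations, with the indistinguishable integrals
  have hJae : ∀ᵐ ω ∂P, ∀ e n i j t, (⟨Jr e n i j t ω, Ji e n i j t ω⟩ : ℂ) = J e n i j t ω := by
    have h1 : ∀ᵐ ω ∂P, ∀ e n i j, ∀ t, Jr e n i j t ω = (J e n i j t ω).re :=
      ae_all_iff.2 fun e => ae_all_iff.2 fun n => ae_all_iff.2 fun i => ae_all_iff.2 fun j => hJrae e n i j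
    have h2 : ∀ᵐ ω ∂P, ∀ e n i j, ∀ t, Ji e n i j t ω = (J e n i j t ω).im :=
      ae_all_iff.2 fun e => ae_all_iff.2 fun n => ae_all_iff.2 fun i => ae_all_iff.2 fun j => hJiae e n i j
    filter_upwards [h1, h2] with ω hω1 hω2 e n i j t
    exact Complex.ext (by simp [hω1 e n i j t]) (by simp [hω2 e n i j t])
  filter_upwards [hUeq, hJae] with ω hω hωJ t e i j
  rw [hω t e i j]
  congr 1
  exact Finset.sum_congr rfl fun n _ => (hωJ e n i j t).symm

end Summit.QuantumFields.YangMills.Theorems.ColdStartUniversality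

end
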